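import Literature.Computability.MetaComplexity.HierarchicalParityCombStep
import Literature.Computability.MetaComplexity.GaussianWidthDepthFregeRows
import Literature.Computability.MetaComplexity.LinearMapResolutionWidthProofs
import HarnessLib

/-!
# Gaussian elimination inside bounded-depth Frege, I: the ends and the rows

Fourth layer of the depth-dependent bounded-depth Frege upper bound for linear algebra over `𝔽₂`
(`DepthFregeGaussianElimination.lean`). For a system `E : Fin m → LinEqMod 2 n` with `n ≤ a^D`,
`F = ofCNF (sumEncoding 1 E)`, in the bounded calculus `TextbookFrege.BD`:

* `startS`, `endS` — `⊢ hp a ∅ j b false` and `⊢ ¬ hp a ∅ j b true` (variable-free formulas: truth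
  tables with NO case split);
* `GaussFrege.rowGenS` — a formula `A` over the variables of row `e` implied by its clauses is
  derivable in the context `¬F` (the generic form of `GaussFrege.rowS`: one truth table over the
  `≤ ℓ` variables of the row, `2^ℓ` cuts against clause extractions);
* `rowSet`, `rowBit`, `hp_row_eval`, `rowHpS` — applied to `A = hp a (rowSet E e) D 0 (rowBit E e)`,
  the row's parity in hierarchical form at the root block.

All statements are proved; line counts are explicit (`endLines`, `GaussFrege.rowLines`).

References: J. Håstad, J. ACM 68 (2021), §1; N. Galesi, D. Itsykson, A. Riazanov, A. Sofronova,
APAL 174 (2023), Lemma 4, §4.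
-/

namespace Literature.Computability.MetaComplexity

open Complexity Complexity.PropForm TextbookFrege KrajicekRamsey Finset Complexity.Stockmeyer

namespace HierParity

variable {a : ℕ}

/-! ### The two ends: variable-free formulas -/

/-- Line count of the truth-table derivation of a variable-free formula of size `≤ P`. [folklore] -/
def endLines (P : ℕ) : ℕ :=
  2 ^ 0 * ((P + 2) * (100 * (0 + 8) ^ 2) + 50 * (0 + 1 + 3) ^ 2 + 2)

/-- Formulas of the empty set have no variables. [folklore] -/
theorem not_mem_vars_hp_empty (ha : 0 < a) (j b : ℕ) (c : Bool) (x : ℕ) : x ∉ (hp a ∅ j b c).vars :=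
  fun hx => by simpa using (mem_vars_hp ha ∅ j b c hx).1

/-- **START**: `⊢ hp a ∅ j b false` ("the empty set has parity `0`"). [folklore] -/
theorem startS (ha : 0 < a) (j b : ℕ) {D B : ℕ} (hD : 2 * j + 13 ≤ D) (hB : 40 * (hsz a j + 2) + 200 ≤ B) :
    BD D B (endLines (hsz a j)) (disjList [hp a ∅ j b false]) := by
  have hsz1 := size_hp_le (a := a) ∅ j b false
  refine tautSeqW [hp a ∅ j b false] [] List.nodup_nil (N := 0) (G := 1) (by simp) (by simp)
    (fun A hA x hx => ?_) (fun τ => ⟨_, List.mem_cons_self, ?_⟩) (q := 2 * j + 5) ?_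
    (S₀ := hsz a j + 2) ?_ (by omega) (by omega)
  · rw [List.mem_singleton] at hA; subst hA
    exact absurd hx (not_mem_vars_hp_empty ha j b false x)
  · rw [eval_hp ha, cnt_empty]; simp
  · intro A hA; rw [List.mem_singleton] at hA; subst hA
    have := altDepth_hp_le (a := a) ∅ j b false; omega
  · simp only [msum_cons, msum_nil]; omega

/-- **END**: `⊢ ¬ hp a ∅ j b true` ("the empty set does not have parity `1`"). [folklore] -/
theorem endS (ha : 0 < a) (j b : ℕ) {D B : ℕ} (hD : 2 * j + 13 ≤ D) (hB : 40 * (hsz a j + 2) + 200 ≤ B) :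
    BD D B (endLines (hsz a j)) (disjList [neg (hp a ∅ j b true)]) := by
  have hsz1 := size_hp_le (a := a) ∅ j b true
  refine tautSeqW [neg (hp a ∅ j b true)] [] List.nodup_nil (N := 0) (G := 1) (by simp) (by simp)
    (fun A hA x hx => ?_) (fun τ => ⟨_, List.mem_cons_self, ?_⟩) (q := 2 * j + 5) ?_
    (S₀ := hsz a j + 2) ?_ (by omega) (by omega)
  · rw [List.mem_singleton] at hA; subst hA
    exact absurd (by simpa [PropForm.vars] using hx) (not_mem_vars_hp_empty ha j b true x)
  · have h : ¬ (hp a ∅ j b true).eval τ = true := by rw [eval_hp ha, cnt_empty]; simp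
    simpa [eval] using h
  · intro A hA; rw [List.mem_singleton] at hA; subst hA
    have h1 := altDepthAux_hp_le (a := a) ∅ j b true 1
    simp only [altDepth, altDepthAux, show (0 : ℕ) ≠ 1 from by decide, if_false]; omega
  · simp only [msum_cons, msum_nil, size]; omega

end HierParity

/-! ### A formula implied by the clauses of a row is derivable (generic form of `GaussFrege.rowS`) -/

namespace GaussFrege

variable {D B m n ℓ : ℕ} (E : Fin m → LinEqMod 2 n)

/-- **Generic row lemma.** Let `A` be a formula over the variables of row `e`, of size `≤ P`,
disjunct depth `≤ dA` and alternation depth `≤ dA + 1`, true whenever all clauses of the row are.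
Then `⊢ A, ¬F` (`F = ofCNF (sumEncoding 1 E)`) has a bounded derivation with
`≤ rowLines ℓ P |F|` lines of disjunct depth `≤ D` (`D ≥ dA + 12`): one truth table over the `≤ ℓ`
variables of the row, its `≤ 2^ℓ` negated clauses cut away against the clause extractions.
[cite: GalesiEtAl2023, Lemma 4, §4] -/
theorem rowGenS {P dA : ℕ} (hE : ∀ e, (E e).supp.card ≤ ℓ) (hP : 2 ^ ℓ * (3 * ℓ + 2) + 1 ≤ P)
    (e : Fin m) (A : PropForm ℕ) (hAsize : A.size ≤ P) (hAdd : A.dd ≤ dA)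
    (hAdepth : A.altDepth ≤ dA + 1) (hAvars : ∀ x ∈ A.vars, x ∈ eqVars 1 (E e))
    (hAeval : ∀ τ : ℕ → Bool, (∀ c ∈ equationCNF 1 (E e), c.eval τ = true) → A.eval τ = true)
    (hdA : 3 ≤ dA) (hD : dA + 12 ≤ D)
    (hB : 40 * (P + 2 ^ ℓ * (3 * ℓ + 4) + ℓ) + 16 * (PropForm.ofCNF (sumEncoding 1 E)).size + 600 ≤ B) :
    BD D B (rowLines ℓ P (PropForm.ofCNF (sumEncoding 1 E)).size)
      (disjList [A, neg (PropForm.ofCNF (sumEncoding 1 E))]) := by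
  have hqℓ : (E e).supp.card ≤ ℓ := hE e
  -- the variable list `V` and the clause list `Lc` of the row
  have hVnd : (eqVars 1 (E e)).Nodup := nodup_eqVars 1 (E e)
  have hVlen : (eqVars 1 (E e)).length ≤ ℓ := by rw [length_eqVars_one]; exact hqℓ
  have hLclen : (equationCNF 1 (E e)).length ≤ 2 ^ ℓ := length_equationCNF_one_le (E e) hqℓ
  have hLcT : ∀ c ∈ equationCNF 1 (E e), c ∈ sumEncoding 1 E :=
    fun c hc => mem_sumEncoding_of_mem_equationCNF E e hc
  have hLcvars : ∀ c ∈ equationCNF 1 (E e), ∀ l ∈ c, l.1 ∈ eqVars 1 (E e) := by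
    intro c hc l hl
    rw [equationCNF] at hc
    exact fst_mem_of_mem_canonicalCNF hc hl
  generalize hV : eqVars 1 (E e) = V at hVnd hVlen hAvars hLcvars
  generalize hLc : equationCNF 1 (E e) = Lc at hLclen hLcT hLcvars hAeval
  -- the rendered CNF `F`
  have hTk : ∀ c' ∈ sumEncoding 1 E, List.length c' ≤ ℓ := by
    intro c' hc'
    simp only [sumEncoding, List.mem_flatMap, List.mem_finRange, true_and] at hc'
    obtain ⟨k, hk⟩ := hc'
    exact length_of_mem_equationCNF_le (hE k) hk
  have hddnF : (neg (PropForm.ofCNF (sumEncoding 1 E))).dd ≤ 4 := dd_neg_ofCNF_le _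
  generalize hF : PropForm.ofCNF (sumEncoding 1 E) = F at hddnF hB ⊢
  have hF1 := altDepthAux_le_dd_succ 1 (neg F)
  -- the negated clauses of the row
  have hXslen : (Lc.map fun c => neg (clauseOf c)).length ≤ 2 ^ ℓ := by
    rw [List.length_map]; exact hLclen
  have hXmem : ∀ X ∈ Lc.map (fun c => neg (clauseOf c)), ∃ c ∈ Lc, X = neg (clauseOf c) := by
    intro X hX
    obtain ⟨c, hc, rfl⟩ := List.mem_map.1 hX
    exact ⟨c, hc, rfl⟩
  have hXtaut : ∀ τ : ℕ → Bool, (∃ X ∈ Lc.map (fun c => neg (clauseOf c)), X.eval τ = true) ∨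
      A.eval τ = true := by
    intro τ
    by_cases hall : ∀ c ∈ Lc, c.eval τ = true
    · exact Or.inr (hAeval τ hall)
    · push Not at hall
      obtain ⟨c, hc, hcτ⟩ := hall
      refine Or.inl ⟨neg (clauseOf c), List.mem_map.2 ⟨c, hc, rfl⟩, ?_⟩
      simp [PropForm.eval, eval_clauseOf', hcτ]
  generalize hXs : Lc.map (fun c => neg (clauseOf c)) = Xs at hXslen hXmem hXtaut
  have hXsize : ∀ X ∈ Xs, X.size ≤ 3 * ℓ + 2 := by
    intro X hX
    obtain ⟨c, hc, rfl⟩ := hXmem X hX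
    have h1 := OntoPHPReduction.size_clauseOf_le c
    have h2 := hTk c (hLcT c hc)
    simp only [size]; nlinarith
  have hXdd : ∀ X ∈ Xs, X.dd ≤ 3 := by
    intro X hX
    obtain ⟨c, -, rfl⟩ := hXmem X hX
    exact dd_neg_clauseOf_le c
  have hmsumXs : msum Xs ≤ 2 ^ ℓ * (3 * ℓ + 3) := by
    have h := msum_le_length_mul (L := Xs) (W := 3 * ℓ + 3) fun X hX => by
      have := hXsize X hX; omega
    exact h.trans (Nat.mul_le_mul_right _ hXslen)
  have hfu : 2 ^ ℓ * (3 * ℓ + 3) ≤ 2 ^ ℓ * (3 * ℓ + 4) := Nat.mul_le_mul_left _ (by omega)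
  -- (1) the truth table `⊢ A, ¬C₁, …, ¬C_q`
  have htaut : ∀ τ : ℕ → Bool, ∃ X ∈ A :: Xs, X.eval τ = true := by
    intro τ
    rcases hXtaut τ with ⟨X, hX, hXτ⟩ | hAτ
    · exact ⟨X, List.mem_cons_of_mem _ hX, hXτ⟩
    · exact ⟨A, List.mem_cons_self, hAτ⟩
  have hvars : ∀ X ∈ A :: Xs, ∀ x ∈ X.vars, x ∈ V := by
    intro X hX x hx
    rcases List.mem_cons.1 hX with rfl | hX
    · exact hAvars x hx
    · obtain ⟨c, hc, rfl⟩ := hXmem X hX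
      simp only [PropForm.vars] at hx
      obtain ⟨l, hl, rfl⟩ := OntoPHPReduction.exists_of_mem_vars_clauseOf hx
      exact hLcvars c hc l hl
  have hq3 : ∀ X ∈ A :: Xs, X.altDepth ≤ dA + 1 := by
    intro X hX
    rcases List.mem_cons.1 hX with rfl | hX
    · exact hAdepth
    · obtain ⟨c, -, rfl⟩ := hXmem X hX
      exact (altDepth_neg_clauseOf_le c).trans (by omega)
  have t₀ : BD D B (2 ^ ℓ * ((P + 1 + 2 ^ ℓ * (3 * ℓ + 4)) * (100 * (ℓ + 8) ^ 2) +
      50 * (ℓ + (2 ^ ℓ + 1) + 3) ^ 2 + 2)) (disjList (A :: Xs)) :=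
    tautSeqW (A :: Xs) V hVnd hVlen (G := 2 ^ ℓ + 1)
      (by rw [List.length_cons]; omega) hvars htaut hq3 (S₀ := P + 1 + 2 ^ ℓ * (3 * ℓ + 4))
      (by rw [msum_cons]; nlinarith) (by omega) (by omega)
  -- (2) reorder: negated clauses first, then `A, ¬F`
  have hctx : ∀ X ∈ Xs ++ [A, neg F], X.dd ≤ dA + 4 := by
    intro X hX
    rcases List.mem_append.1 hX with hX | hX
    · exact (hXdd X hX).trans (by omega)
    · simp only [List.mem_cons, List.not_mem_nil, or_false] at hX
      rcases hX with rfl | rfl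
      · exact hAdd.trans (by omega)
      · exact hddnF.trans (by omega)
  have hszL' : (disjList (Xs ++ [A, neg F])).size ≤ 2 ^ ℓ * (3 * ℓ + 3) + P + F.size + 4 := by
    rw [size_disjList_eq_msum, msum_append, msum_cons, msum_cons, msum_nil]
    simp only [size]; omega
  have t₁ : BD D B (2 ^ ℓ * ((P + 1 + 2 ^ ℓ * (3 * ℓ + 4)) * (100 * (ℓ + 8) ^ 2) +
      50 * (ℓ + (2 ^ ℓ + 1) + 3) ^ 2 + 2) + 50 * (2 ^ ℓ + 3 + 1) ^ 2)
      (disjList (Xs ++ [A, neg F])) := by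
    refine subsetN (N := 2 ^ ℓ + 3) t₀ ?_ hctx (by omega) ?_ (by rw [List.length_cons]; omega)
      (by rw [List.length_append, List.length_cons, List.length_cons, List.length_nil]; omega)
    · intro X hX
      rcases List.mem_cons.1 hX with rfl | hX
      · exact List.mem_append_right _ List.mem_cons_self
      · exact List.mem_append_left _ hX
    · rw [size_disjList_eq_msum, msum_cons]
      omega
  -- (3) cut the negated clauses away against `⊢ ¬¬Cᵢ, …`
  have hFmem : ∀ K : List (PropForm ℕ), neg F ∈ K ++ [A, neg F] := fun K =>
    List.mem_append_right _ (List.mem_cons_of_mem _ List.mem_cons_self)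
  have hx : ∀ x ∈ Xs, ∀ K, K <:+ Xs →
      BD D B (130 * (F.size + 2) + 50 * (2 ^ ℓ + 3 + 1) ^ 2 + 456)
        (disjList (neg x :: (K ++ [A, neg F]))) := by
    intro x hx K hK
    obtain ⟨c, hc, rfl⟩ := hXmem x hx
    have hKsub : ∀ X ∈ K, X ∈ Xs := fun X hX => hK.subset hX
    have hKlen : K.length ≤ 2 ^ ℓ := (hK.length_le).trans hXslen
    have hmK : msum K ≤ 2 ^ ℓ * (3 * ℓ + 3) := (msum_le_of_sublist hK.sublist).trans hmsumXs
    refine negNegClauseS (hLcT c hc) hF hTk (K ++ [A, neg F]) (NL := 2 ^ ℓ + 3)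
      (by rw [List.length_append, List.length_cons, List.length_cons, List.length_nil]; omega)
      (hFmem K) (p := dA + 4) ?_ (by omega) (by omega) ?_
    · intro X hX
      rcases List.mem_append.1 hX with hX | hX
      · exact (hXdd X (hKsub X hX)).trans (by omega)
      · simp only [List.mem_cons, List.not_mem_nil, or_false] at hX
        rcases hX with rfl | rfl
        · exact hAdd.trans (by omega)
        · exact hddnF.trans (by omega)
    · rw [msum_append, msum_cons, msum_cons, msum_nil]
      simp only [size]
      omega
  have hs : 2 * (disjList (Xs ++ [A, neg F])).size + 1 ≤ B := by omega
  have fin := elimAllN Xs t₁ hx hs (N := 2 ^ ℓ) hXslen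
  have hrl : rowLines ℓ P F.size =
      2 ^ ℓ * ((P + 1 + 2 ^ ℓ * (3 * ℓ + 4)) * (100 * (ℓ + 8) ^ 2) +
        50 * (ℓ + (2 ^ ℓ + 1) + 3) ^ 2 + 2) + 50 * (2 ^ ℓ + 3 + 1) ^ 2 +
        2 ^ ℓ * (130 * (F.size + 2) + 50 * (2 ^ ℓ + 3 + 1) ^ 2 + 456 + 2) := by
    simp only [rowLines]
    ring
  rw [hrl]
  exact fin

end GaussFrege

namespace HierParity

variable {a : ℕ}

/-! ### The rows in hierarchical form -/

section RowHp

variable {m n : ℕ} (E : Fin m → LinEqMod 2 n)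

/-- The support of row `e`, as a set of variable indices. [folklore] -/
def rowSet (e : Fin m) : Finset ℕ := (E e).supp.image Fin.val

/-- The right-hand side of row `e`, as a bit. [folklore] -/
def rowBit (e : Fin m) : Bool := decide (Odd (E e).2.val)

variable {E}

/-- `bz (rowBit e)` is the right-hand side. [folklore] -/
theorem bz_rowBit (e : Fin m) : bz (rowBit E e) = (E e).2 := by
  rw [rowBit, bz_decide_odd, ZMod.natCast_zmod_val]

/-- Membership in `rowSet`. [folklore] -/
theorem mem_rowSet {e : Fin m} {x : ℕ} : x ∈ rowSet E e ↔ ∃ i ∈ (E e).supp, (i : ℕ) = x := by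
  simp [rowSet]

/-- Indices in `rowSet` are `< n`. [folklore] -/
theorem lt_of_mem_rowSet {e : Fin m} {x : ℕ} (h : x ∈ rowSet E e) : x < n := by
  obtain ⟨i, -, rfl⟩ := mem_rowSet.1 h; exact i.2

/-- **The row's parity in hierarchical form is implied by its clauses**: if the equation of row
`e` holds at the values induced by `τ`, then the number of true variables of its support has the
parity of its right-hand side, at the root block `(D, 0)` (all indices `< n ≤ a^D`). [folklore] -/
theorem hp_row_eval (ha : 0 < a) {D : ℕ} (hn : n ≤ a ^ D) (e : Fin m) (τ : ℕ → Bool)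
    (h : (E e).Holds (blockVals 2 1 n τ)) : (hp a (rowSet E e) D 0 (rowBit E e)).eval τ = true := by
  rw [eval_hp ha, cnt_root (fun v hv => (lt_of_mem_rowSet hv).trans_le hn), bz_rowBit]
  unfold LinEqMod.Holds at h
  rw [← h]
  have h01 : ∀ b : ZMod 2, b = 0 ∨ b = 1 := by decide
  -- the left-hand side counts the true variables of the support
  have hsum : ∑ j, (E e).1 j * blockVals 2 1 n τ j =
      ∑ j ∈ (E e).supp.filter (fun j : Fin n => τ (j : ℕ) = true), (1 : ZMod 2) := by
    rw [sum_filter, ← sum_subset (subset_univ (E e).supp)]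
    · refine sum_congr rfl fun j hj => ?_
      rw [LinEqMod.mem_supp] at hj
      rcases h01 ((E e).1 j) with h0 | h1
      · exact absurd h0 hj
      · rw [h1, one_mul, blockVals_two_one_apply]
    · intro j _ hj
      rw [LinEqMod.mem_supp, not_not] at hj
      rw [hj, zero_mul]
  rw [hsum, sum_const, nsmul_eq_mul, mul_one]
  congr 1
  rw [rowSet, filter_image, card_image_of_injective _ Fin.val_injective]

variable (E)

/-- **The row sequent in hierarchical form**: `⊢ hp a (rowSet e) D 0 (rowBit e), ¬F`.
[cite: GalesiEtAl2023, Lemma 4, §4] -/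
theorem rowHpS (ha : 0 < a) {Dl ℓ P D B : ℕ} (hn : n ≤ a ^ Dl) (hE : ∀ e, (E e).supp.card ≤ ℓ)
    (hP : 2 ^ ℓ * (3 * ℓ + 2) + 1 ≤ P) (hPh : hsz a Dl ≤ P) (hD : 2 * Dl + 15 ≤ D)
    (hB : 40 * (P + 2 ^ ℓ * (3 * ℓ + 4) + ℓ) + 16 * (PropForm.ofCNF (sumEncoding 1 E)).size + 600 ≤ B)
    (e : Fin m) :
    BD D B (GaussFrege.rowLines ℓ P (PropForm.ofCNF (sumEncoding 1 E)).size)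
      (disjList [hp a (rowSet E e) Dl 0 (rowBit E e), neg (PropForm.ofCNF (sumEncoding 1 E))]) := by
  refine GaussFrege.rowGenS E hE hP e _ ((size_hp_le _ _ _ _).trans hPh)
    ((dd_hp_le _ _ _ _).trans (Nat.le_succ _)) ((altDepth_hp_le _ _ _ _).trans (by omega))
    (fun x hx => ?_) (fun τ hall => ?_) (dA := 2 * Dl + 3) (by omega) (by omega) hB
  · obtain ⟨i, hi, rfl⟩ := mem_rowSet.1 (mem_vars_hp ha _ Dl 0 _ hx).1
    exact mem_eqVars_one.2 ⟨i, hi, rfl⟩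
  · refine hp_row_eval ha hn e τ ?_
    have h1 : (equationCNF 1 (E e)).eval τ = true := (CNF.eval_eq_true_iff _ _).2 hall
    rw [eval_equationCNF] at h1
    exact of_decide_eq_true h1

end RowHp

end HierParity

end Literature.Computability.MetaComplexity
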